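import Literature.Analysis.FluidPDE.TorusNSBeiraoDaVeigaCriterion
import HarnessLib

/-!
# The `H²` square of Gibbon's chessboard: `∫₀ᵀ ‖Δu‖₂^{4/3} dt < ∞` suffices, for classical
# Navier–Stokes solutions on `T³` (continuation form)

Analysis/FluidPDE proof file (theorems only; no definitions, no named facts).

Search for candidate a priori estimates; no regularity claim. Sequel of
`TorusNSBeiraoDaVeigaCriterion.lean`. Gibbon (J. Nonlinear Sci. 29 (2019), Thm 2 (iii) with
Remark 2): for `n ≥ 1`, `1 ≤ m ≤ ∞`, `α_{n,m} = 2m/(2m(n+1)−3)`, a sufficient condition for strong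
solutions is `M_{n,m,T}(u) = ∫₀ᵀ ‖∇ⁿu‖_{L^{2m}}^{2α_{n,m}} dt < ∞`; the square `(n,m) = (2,1)` reads
`∫₀ᵀ ‖∇²u‖₂^{4/3} dt < ∞` (`2α_{2,1} = 4/3`), the "wanted" partner of the Foias–Guillopé–Temam a
priori bound `∫₀ᵀ ‖Δu‖₂^{2/3} dt < ∞` (`α_{2,1} = 2/3`, tree:
`Torus.classicalNS_integral_laplacian_twoThirds_le`). On the torus `‖∇²u‖₂ = ‖Δu‖₂` for smooth
periodic fields.

The printed proof (Gibbon 2019, Appendix B) runs through local existence in `Ẇ^{n,2m}` and the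
minimal blow-up rate; here — a genuinely shorter road with the tree's tools — the square `(2,1)`
is reduced to Beirão da Veiga's gradient criterion at `s = 6` (`r = 2s/(2s−3) = 4/3`, tree:
`Torus.classicalNS_continuation_of_gradLs_rpow_integral_le`) through the periodic Sobolev bound
`‖∇u‖_{L⁶} ≤ C ‖Δu‖_{L²}` (tree: `Torus.exists_integral_gradSq_cube_le_laplacianSq_cube`).

* `Torus.exists_gradL6_le_laplacianL2` — `(∫ |∇v|⁶)^{1/6} ≤ K (∫ ‖Δv‖²)^{1/2}` for smooth `v` on
  `T^d`, `card d = 3`, `|∇v| = (∑ⱼ‖∂ⱼv‖²)^{1/2}` (real-exponent form of the tree's cube bound).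
* `Torus.classicalNS_continuation_of_laplacianL2_rpow_integral_le` — **the `(2,1)` square on
  `T³`, continuation form**: along a classical solution of the unforced Navier–Stokes equations
  (`ν > 0`, mean-zero slices) on `[0, T) × T^d`, a continuous majorant `N(t) ≥ ‖Δu(t)‖_{L²}` with
  `∫₀ᵗ N^{4/3} ≤ I` on `[0, T)` gives continuation past `T`.

Scope (faithfulness): classical solutions with mean-zero slices on the unit torus, continuous
majorant with bounded primitive in place of `u ∈ L^{4/3}(0,T; Ḣ²)`; only the square `(2,1)` of
Thm 2 (iii) (rows `n = 0`, `n = 1` are the tree's Serrin / Beirão da Veiga files; squares with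
`2m(n−1) > 3` need the printed local-existence route and are not attempted here).

## Mathlib / tree search

Tree (used): `Torus.exists_integral_gradSq_cube_le_laplacianSq_cube` (`TorusNSSerrinCriterion`),
`Torus.classicalNS_continuation_of_gradLs_rpow_integral_le` (`TorusNSBeiraoDaVeigaCriterion`).
Searched: `laplacian.*4 ?/ ?3|H2.*criterion|Gibbon.*square` — nothing for the sufficient side.

## References

* [Gibbon2019Chessboard] J. D. Gibbon, *Weak and strong solutions of the 3D Navier–Stokes
  equations and their relation to a chessboard of convergent inverse length scales*,
  J. Nonlinear Sci. 29 (2019) 215–228 = arXiv:1803.11518, Thm 2 (iii), Remark 2, Appendix B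
  (held text pp. 5, 8).
* [BeiraoDaVeiga1995] H. Beirão da Veiga, Chinese Ann. Math. Ser. B 16 (1995) 407–412 (the
  gradient criterion at `s = 6`).
-/

noncomputable section

open Set MeasureTheory intervalIntegral Filter Real
open scoped InnerProductSpace RealInnerProductSpace Topology ENNReal

namespace Literature.Analysis.FluidPDE

open Literature.Analysis.FunctionSpaces

variable {d : Type*} [Fintype d] [DecidableEq d]

/-- **Periodic Sobolev bound `‖∇v‖_{L⁶} ≤ K‖Δv‖_{L²}`** on `T^d`, `card d = 3`, real-exponent form:
`(∫ ((∑ⱼ‖∂ⱼv‖²)^{1/2})⁶)^{1/6} ≤ K (∫ ‖Δv‖²)^{1/2}` for smooth `v` (from the tree's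
`∫ (∑ⱼ‖∂ⱼv‖²)³ ≤ C (∫‖Δv‖²)³`, `K = C^{1/6}`; the step "`‖∇u‖_{L⁶} ≤ c‖Au‖`" of
Robinson–Rodrigo–Sadowski 2016, proof of Lemma 8.16, Sobolev `H¹ ⊂ L⁶` of Thm 1.18).
[cite: RobinsonRodrigoSadowskiCUP2016, Lemma 8.16 (proof: ‖∇u‖_{L⁶} ≤ c‖Au‖)] -/
theorem Torus.exists_gradL6_le_laplacianL2 (hd : Fintype.card d = 3) :
    ∃ K : ℝ, 0 ≤ K ∧ ∀ v : UnitAddTorus d → EuclideanSpace ℝ d, Torus.IsSmooth v →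
      (∫ x, Real.sqrt (∑ j, ‖Torus.partialDeriv j v x‖ ^ 2) ^ (6 : ℝ)) ^ (1 / (6 : ℝ)) ≤
        K * Real.sqrt (∫ x, ‖Torus.laplacian v x‖ ^ 2) := by
  obtain ⟨C, hC0, hC⟩ := Torus.exists_integral_gradSq_cube_le_laplacianSq_cube (d := d) hd
  refine ⟨C ^ (1 / (6 : ℝ)), Real.rpow_nonneg hC0 _, fun v hv => ?_⟩
  have hP0 : 0 ≤ ∫ x, ‖Torus.laplacian v x‖ ^ 2 := integral_nonneg fun _ => sq_nonneg _
  have e : ∀ x, Real.sqrt (∑ j, ‖Torus.partialDeriv j v x‖ ^ 2) ^ (6 : ℝ) =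
      (∑ j, ‖Torus.partialDeriv j v x‖ ^ 2) ^ 3 := by
    intro x
    have hs0 : 0 ≤ ∑ j, ‖Torus.partialDeriv j v x‖ ^ 2 :=
      Finset.sum_nonneg fun _ _ => sq_nonneg _
    rw [show (6 : ℝ) = ((6 : ℕ) : ℝ) by norm_num, Real.rpow_natCast,
      show (6 : ℕ) = 2 * 3 by norm_num, pow_mul, Real.sq_sqrt hs0]
  simp_rw [e]
  have h1 := hC v hv
  have hL0 : 0 ≤ ∫ x, (∑ j, ‖Torus.partialDeriv j v x‖ ^ 2) ^ 3 :=
    integral_nonneg fun _ => pow_nonneg (Finset.sum_nonneg fun _ _ => sq_nonneg _) _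
  calc (∫ x, (∑ j, ‖Torus.partialDeriv j v x‖ ^ 2) ^ 3) ^ (1 / (6 : ℝ))
      ≤ (C * (∫ x, ‖Torus.laplacian v x‖ ^ 2) ^ 3) ^ (1 / (6 : ℝ)) :=
        Real.rpow_le_rpow hL0 h1 (by norm_num)
    _ = C ^ (1 / (6 : ℝ)) * Real.sqrt (∫ x, ‖Torus.laplacian v x‖ ^ 2) := by
        rw [Real.mul_rpow hC0 (pow_nonneg hP0 _), show ((∫ x, ‖Torus.laplacian v x‖ ^ 2) ^ 3 :
          ℝ) = (∫ x, ‖Torus.laplacian v x‖ ^ 2) ^ (3 : ℝ) by norm_cast, ← Real.rpow_mul hP0,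
          Real.sqrt_eq_rpow]
        norm_num

/-- **Gibbon's chessboard, square `(n,m) = (2,1)`: `∫₀ᵀ ‖Δu‖₂^{4/3} dt < ∞` suffices** (Gibbon
2019, Thm 2 (iii), Remark 2: `M_{2,1,T}(u) = ∫₀ᵀ ‖∇²u‖₂^{2α_{2,1}} dt < ∞`, `2α_{2,1} = 4/3`), here
on the unit torus `T^d`, `card d = 3`, for classical solutions in continuation form. Let `(u, p)`
be a classical solution of the unforced Navier–Stokes equations with viscosity `ν > 0` on
`[0, T) × T^d`, `T > 0`, with mean-zero velocity slices, and let `N` be a continuous nonnegative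
majorant of `‖Δu(t)‖_{L²}` on `[0, T)` with `∫₀ᵗ N^{4/3} ≤ I` for all `t ∈ [0, T)`. Then the
solution continues to a classical solution with mean-zero slices on some `[0, T'] × T^d`,
`T' > T`, equal to `u` on `[0, T)`. Proof: `‖∇u‖_{L⁶} ≤ K‖Δu‖_{L²}`
(`Torus.exists_gradL6_le_laplacianL2`) and Beirão da Veiga's criterion at `s = 6`, `r = 4/3`
(`Torus.classicalNS_continuation_of_gradLs_rpow_integral_le`) — not the printed blow-up-rate
argument. [cite: Gibbon2019Chessboard, Thm 2 (iii) + Remark 2, square (n,m) = (2,1)] -/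
theorem Torus.classicalNS_continuation_of_laplacianL2_rpow_integral_le (hd : Fintype.card d = 3)
    {ν T : ℝ} (hν : 0 < ν) (hT : 0 < T)
    {u : ℝ → UnitAddTorus d → EuclideanSpace ℝ d} {p : ℝ → UnitAddTorus d → ℝ}
    (h : Torus.IsClassicalNSSolutionOn (Ico 0 T) ν 0 u p)
    (hmean : ∀ t ∈ Ico 0 T, Torus.HasZeroMean (u t)) {N : ℝ → ℝ}
    (hNc : ContinuousOn N (Ico 0 T)) (hN0 : ∀ t ∈ Ico 0 T, 0 ≤ N t)
    (hN : ∀ t ∈ Ico 0 T, Real.sqrt (∫ x, ‖Torus.laplacian (u t) x‖ ^ 2) ≤ N t)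
    {I : ℝ} (hI : ∀ t ∈ Ico 0 T, ∫ τ in (0 : ℝ)..t, N τ ^ ((4 : ℝ) / 3) ≤ I) :
    ∃ T' : ℝ, T < T' ∧ ∃ (u' : ℝ → UnitAddTorus d → EuclideanSpace ℝ d)
      (p' : ℝ → UnitAddTorus d → ℝ), Torus.IsClassicalNSSolutionOn (Icc 0 T') ν 0 u' p' ∧
        (∀ t ∈ Icc 0 T', Torus.HasZeroMean (u' t)) ∧ ∀ t ∈ Ico 0 T, u' t = u t := by
  obtain ⟨K, hK0, hK⟩ := Torus.exists_gradL6_le_laplacianL2 (d := d) hd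
  have hs : (3 : ℝ) / 2 < 6 := by norm_num
  have hr : 2 * (6 : ℝ) / (2 * 6 - 3) = 4 / 3 := by norm_num
  refine Torus.classicalNS_continuation_of_gradLs_rpow_integral_le hd hν hT hs h hmean
    (N := fun t => K * N t) (continuousOn_const.mul hNc) (fun t ht => mul_nonneg hK0 (hN0 t ht))
    (fun t ht => ?_) (I := K ^ ((4 : ℝ) / 3) * I) (fun t ht => ?_)
  · have hut : Torus.IsSmooth (u t) := h.smooth_velocity.isSmooth_slice ht
    exact (hK (u t) hut).trans (mul_le_mul_of_nonneg_left (hN t ht) hK0)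
  · have ht0 : 0 ≤ t := ht.1
    rw [hr]
    have e : ∫ τ in (0 : ℝ)..t, (K * N τ) ^ ((4 : ℝ) / 3) =
        ∫ τ in (0 : ℝ)..t, K ^ ((4 : ℝ) / 3) * N τ ^ ((4 : ℝ) / 3) := by
      refine intervalIntegral.integral_congr fun τ hτ => ?_
      rw [uIcc_of_le ht0] at hτ
      have hτ' : τ ∈ Ico 0 T := ⟨hτ.1, hτ.2.trans_lt ht.2⟩
      exact Real.mul_rpow hK0 (hN0 τ hτ')
    rw [e, intervalIntegral.integral_const_mul]
    exact mul_le_mul_of_nonneg_left (hI t ht) (Real.rpow_nonneg hK0 _)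

end Literature.Analysis.FluidPDE

end
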